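import Literature.NumberTheory.QuadraticForms.LandherrHermitianIsotropy
import HarnessLib

/-!
# Landherr: an anisotropic hermitian form of rank ≥ 3 over a CM field is definite at some complex place

Topic `NumberTheory/QuadraticForms`; theorems only (no definition, no named fact, no instance, no notation).

Let `L` be a CM field with complex conjugation `σ = IsCMField.complexConj L` and let `H` be a `σ`-hermitian
matrix (`ᵗ(σH) = H`) of finite size `n ≥ 3` over `L`, with sesquilinear form `⟪u, v⟫_H = ᵗ(σu) H v`
(the tree's `Literature.AlgebraicGeometry.ShimuraVarieties.hermForm σ H`).  **Theorem**
(`hermitianMatrix_exists_posDef_embedding_of_anisotropic`): if `⟪x, x⟫_H = 0` only for `x = 0`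
(the form is ANISOTROPIC over `L`), then at some complex embedding `τ : L →+* ℂ` the complex hermitian matrix
`τ(H)` is positive definite or negative definite; equivalently (`…_infinitePlace_…`) there is an infinite place
`w` of `L` — necessarily complex, `L` being totally complex — at which `H` is definite: the set `S₀` of
[Rogawski1990, §14.2 p. 232] («the infinite places `v` with `G′_v ≅ U₃(ℝ)` compact») is non-empty for the
unitary group of an anisotropic hermitian space of dimension `3`.

Proof.  Anisotropy gives `det H ≠ 0` (`Landherr.det_ne_zero_of_hermForm_anisotropic`: a kernel vector is
isotropic), so `H` diagonalises over `L`, `ᵗ(σg) H g = diag d` with `dᵢ ∈ L⁺ˣ`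
(★ `hermitianMatrix_congruent_diagonal`), and the diagonal form `⟨d⟩` is again anisotropic
(`Landherr.diagonal_anisotropic_of_congr`).  By ★ Landherr's isotropy criterion
`Landherr.hermitianDiagonal_isotropic_iff_indefinite` [La36] (Jacobson's trace form + Hasse–Minkowski over
`L⁺`, O'Meara 66:1) an everywhere-indefinite `⟨d⟩` of rank `≥ 3` would be isotropic; hence at some `τ` all
`τ(dᵢ)` have the same sign, and transporting `diag τ(d)` back along the complex congruence
`(τg)ᴴ τ(H) τ(g) = diag τ(d)` (★ `Landherr.congr_map_embedding`, Mathlib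
`Matrix.IsUnit.posDef_star_left_conjugate_iff`) makes `τ(H)` or `-τ(H)` positive definite
(`Landherr.posDef_map_of_congr_diagonal`, `Landherr.posDef_neg_map_of_congr_diagonal`).  For the place
version, `(InfinitePlace.mk τ).embedding` is `τ` or its conjugate, and `H^{conj ∘ τ} = ᵗ(H^τ)` for a
`σ`-hermitian `H` (`Landherr.map_conjugate_eq_transpose_map`), while positive definiteness is invariant under
transposition.

This is the «anisotropic ⇒ definite somewhere» half of Landherr's theorem [La36] in the form used for compact
unitary groups `U(3)` attached to CM fields (Rogawski 1990 §14.2; Deligne, LNM 900 §4 pp. 44–45): no statement of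
[La36] is a hypothesis — the arithmetic input is the proved tree theorem
`Landherr.hermitianDiagonal_isotropic_iff_indefinite`.

Provenance: cell `hodgecm-mathlib`, F0∕P3a topic T6 (line «ArchTransfersExistCanonicalSingular» pay-down,
node N12 `stub_exists_definite_place`), written against tree vocabulary only.

## References

* W. Landherr, *Äquivalenz Hermitescher Formen über einem beliebigen algebraischen Zahlkörper*, Abh. Math.
  Sem. Univ. Hamburg 11 (1936) 245–248 [Landherr1936HermitianForms].
* J. D. Rogawski, *Automorphic Representations of Unitary Groups in Three Variables*, Annals of Math.
  Studies 123 (1990), §14.2 p. 232 [Rogawski1990].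
* W. Scharlau, *Quadratic and Hermitian Forms*, Grundlehren 270 (1985), Ch. 10 §1 [Scharlau1985HermitianForms].
* P. Deligne, *Hodge cycles on abelian varieties*, in LNM 900 (1982), §4 pp. 44–45 [Deligne1982HodgeCycles].
-/

set_option autoImplicit false

noncomputable section

open NumberField NumberField.InfinitePlace
open scoped Matrix ComplexConjugate ComplexOrder
open Literature.AlgebraicGeometry.ShimuraVarieties (hermForm)

namespace Literature.NumberTheory.QuadraticForms

namespace Landherr

/-! ## §1. Anisotropic ⇒ non-degenerate; transport of anisotropy and of definiteness along a congruence -/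

section Field

variable {K : Type} [Field K] {m : Type} [Fintype m] [DecidableEq m]

/-- An anisotropic sesquilinear form `⟪u, v⟫_H = ᵗ(σu) H v` has non-degenerate Gram matrix: a non-zero kernel
vector of `H` would be isotropic. [folklore] -/
private theorem det_ne_zero_of_hermForm_anisotropic (σ : K →+* K) (H : Matrix m m K)
    (hanis : ∀ x : m → K, hermForm σ H x x = 0 → x = 0) : H.det ≠ 0 := by
  intro hdet
  obtain ⟨v, hv, hHv⟩ := Matrix.exists_mulVec_eq_zero_iff.mpr hdet
  refine hv (hanis v ?_)
  show (σ ∘ v) ⬝ᵥ (H *ᵥ v) = 0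
  rw [hHv, dotProduct_zero]

end Field

section CM

variable (L : Type) [Field L] [NumberField L] [IsCMField L] {ι : Type} [Fintype ι] [DecidableEq ι]

/-- **Transport of anisotropy to a diagonalisation**: if `ᵗ(σg) H g = diag d` with `g` invertible and
`⟪·,·⟫_H` is anisotropic, then the diagonal hermitian form `∑ dᵢ wᵢ σ(wᵢ)` has no non-zero isotropic vector
(`v = g w` would be one for `H`). [folklore] -/
private theorem diagonal_anisotropic_of_congr {H : Matrix ι ι L} (g : GL ι L) {d : ι → L}
    (e : (g : Matrix ι ι L).transpose.map (IsCMField.complexConj L) * H * (g : Matrix ι ι L) =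
      Matrix.diagonal d)
    (hanis : ∀ x : ι → L, hermForm (IsCMField.complexConj L : L →+* L) H x x = 0 → x = 0) :
    ¬ ∃ w : ι → L, w ≠ 0 ∧ ∑ i, d i * (w i * IsCMField.complexConj L (w i)) = 0 := by
  rintro ⟨w, hw, h⟩
  have e' : ((g : Matrix ι ι L).map (IsCMField.complexConj L : L →+* L))ᵀ * H * (g : Matrix ι ι L) =
      Matrix.diagonal d := e
  refine mulVec_ne_zero g hw (hanis ((g : Matrix ι ι L) *ᵥ w) ?_)
  rw [hermForm_mulVec_mulVec, e', hermForm_complexConj_diagonal_self]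
  exact h

/-- **Transport of definiteness along a congruence**: if `ᵗ(σG) H G = diag d` over `L` with `det G` a unit,
the `dᵢ` `σ`-fixed and all `τ(dᵢ) > 0` at the complex embedding `τ`, then `τ(H)` is positive definite — the
complex congruence `(τG)ᴴ τ(H) τ(G) = diag τ(d)` (`congr_map_embedding`) and Mathlib's
`Matrix.IsUnit.posDef_star_left_conjugate_iff`. [folklore] -/
private theorem posDef_map_of_congr_diagonal {G H : Matrix ι ι L} {d : ι → L} (hG : IsUnit G.det)
    (e : G.transpose.map (IsCMField.complexConj L) * H * G = Matrix.diagonal d)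
    (hd : ∀ i, IsCMField.complexConj L (d i) = d i) (τ : L →+* ℂ) (hpos : ∀ i, 0 < (τ (d i)).re) :
    (H.map τ).PosDef := by
  have h1 : (G.map τ)ᴴ * H.map τ * G.map τ = (Matrix.diagonal d).map τ := congr_map_embedding L e τ
  have hU : IsUnit (G.map τ) :=
    (Matrix.isUnit_iff_isUnit_det _).mpr (isUnit_det_map_embedding L hG τ)
  have h2 : ((G.map τ)ᴴ * H.map τ * G.map τ).PosDef := by
    rw [h1]
    exact posDef_map_diagonal L hd τ hpos
  rw [← Matrix.star_eq_conjTranspose] at h2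
  exact (Matrix.IsUnit.posDef_star_left_conjugate_iff hU).mp h2

/-- The same with all `τ(dᵢ) < 0`: then `-τ(H)` is positive definite (apply the previous lemma to `-H` and
`-d`). [folklore] -/
private theorem posDef_neg_map_of_congr_diagonal {G H : Matrix ι ι L} {d : ι → L} (hG : IsUnit G.det)
    (e : G.transpose.map (IsCMField.complexConj L) * H * G = Matrix.diagonal d)
    (hd : ∀ i, IsCMField.complexConj L (d i) = d i) (τ : L →+* ℂ) (hneg : ∀ i, (τ (d i)).re < 0) :
    (-H.map τ).PosDef := by
  have e' : G.transpose.map (IsCMField.complexConj L) * (-H) * G = Matrix.diagonal (fun i => -d i) := by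
    rw [Matrix.mul_neg, Matrix.neg_mul, e, Matrix.diagonal_neg]
  have hd' : ∀ i, IsCMField.complexConj L (-d i) = -d i := fun i => by rw [map_neg, hd i]
  have hpos : ∀ i, 0 < (τ (-d i)).re := fun i => by
    rw [map_neg, Complex.neg_re]
    exact neg_pos.mpr (hneg i)
  have h := posDef_map_of_congr_diagonal L hG e' hd' τ hpos
  rwa [Matrix.map_neg _ (map_neg τ)] at h

omit [Fintype ι] [DecidableEq ι] in
/-- For a `σ`-hermitian `H` over a CM field, the conjugate complex embedding gives the transposed complex matrix:
`H^{conj ∘ τ} = ᵗ(H^τ)` (`τ ∘ σ = conj ∘ τ`, Mathlib `IsCMField.complexEmbedding_complexConj`). [folklore] -/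
private theorem map_conjugate_eq_transpose_map (H : Matrix ι ι L)
    (hH : H.transpose.map (IsCMField.complexConj L) = H) (τ : L →+* ℂ) :
    H.map (ComplexEmbedding.conjugate τ) = (H.map τ)ᵀ := by
  ext i j
  have hij : IsCMField.complexConj L (H j i) = H i j := by
    have h := congrFun (congrFun hH i) j
    simpa only [Matrix.map_apply, Matrix.transpose_apply] using h
  simp only [Matrix.map_apply, Matrix.transpose_apply, ComplexEmbedding.conjugate_coe_eq]
  rw [← hij, IsCMField.complexEmbedding_complexConj, starRingEnd_self_apply]

end CM

end Landherr

/-! ## §2. The theorem -/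

open Landherr in
/-- **Landherr: anisotropic ⇒ definite at some complex embedding** [La36].  Let `L` be a CM field with complex
conjugation `σ`, `H` a `σ`-hermitian matrix (`ᵗ(σH) = H`) of finite size `n ≥ 3` over `L` whose form
`⟪u, v⟫_H = ᵗ(σu) H v` (`hermForm σ H`) is anisotropic (`⟪x, x⟫_H = 0 → x = 0`).  Then at some complex embedding
`τ` of `L` the complex hermitian matrix `τ(H)` is positive definite or negative definite.  Proof: diagonalise
(`hermitianMatrix_congruent_diagonal`); an everywhere-indefinite diagonal form of rank `≥ 3` is isotropic
(`hermitianDiagonal_isotropic_iff_indefinite`, Hasse–Minkowski over `L⁺`); transport definiteness back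
(`posDef_map_of_congr_diagonal`, `posDef_neg_map_of_congr_diagonal`).
[cite: Landherr1936HermitianForms] [cite: Rogawski1990, §14.2 p. 232] -/
theorem hermitianMatrix_exists_posDef_embedding_of_anisotropic (L : Type) [Field L] [NumberField L]
    [IsCMField L] {ι : Type} [Fintype ι] [DecidableEq ι] (H : Matrix ι ι L)
    (hH : H.transpose.map (IsCMField.complexConj L) = H)
    (hanis : ∀ x : ι → L, hermForm (IsCMField.complexConj L : L →+* L) H x x = 0 → x = 0)
    (h3 : 3 ≤ Fintype.card ι) :
    ∃ τ : L →+* ℂ, (H.map τ).PosDef ∨ (-H.map τ).PosDef := by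
  have h0 : H.det ≠ 0 := det_ne_zero_of_hermForm_anisotropic _ H hanis
  obtain ⟨g, d, hd, hd0, e⟩ := hermitianMatrix_congruent_diagonal L H hH h0
  have hG : IsUnit (g : Matrix ι ι L).det := Matrix.isUnits_det_units g
  have hnot := diagonal_anisotropic_of_congr L g e hanis
  by_contra hdef
  simp only [not_exists, not_or] at hdef
  refine hnot ((hermitianDiagonal_isotropic_iff_indefinite L d hd hd0 h3).mpr fun τ => ?_)
  have hne : ∀ i, (τ (d i)).re ≠ 0 := fun i => re_ne_zero_of_isReal (hd i) (hd0 i) τ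
  obtain ⟨hp, hn⟩ := hdef τ
  by_cases hneg : ∃ i, (τ (d i)).re < 0
  · obtain ⟨i, hi⟩ := hneg
    by_cases hpos : ∃ j, 0 < (τ (d j)).re
    · obtain ⟨j, hj⟩ := hpos
      exact ⟨i, j, hi, hj⟩
    · exact absurd (posDef_neg_map_of_congr_diagonal L hG e hd τ fun j =>
        lt_of_le_of_ne (not_lt.mp fun h => hpos ⟨j, h⟩) (hne j)) hn
  · exact absurd (posDef_map_of_congr_diagonal L hG e hd τ fun i =>
      lt_of_le_of_ne (not_lt.mp fun h => hneg ⟨i, h⟩) (hne i).symm) hp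

open Landherr in
/-- **Landherr: anisotropic ⇒ definite at some (complex) infinite place** — `S₀ ≠ ∅` [Rogawski1990, §14.2
p. 232].  Same hypotheses; conclusion: there is an infinite place `w` of the (totally complex) CM field `L`, with
`w` complex, such that `H` is positive or negative definite under the distinguished embedding `w.embedding`
(which is `τ` or `conj ∘ τ` for the `τ` of the previous theorem; `H^{conj ∘ τ} = ᵗ(H^τ)` and definiteness is
transposition-invariant). [cite: Landherr1936HermitianForms] [cite: Rogawski1990, §14.2 p. 232] -/
theorem hermitianMatrix_exists_definite_infinitePlace_of_anisotropic (L : Type) [Field L] [NumberField L]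
    [IsCMField L] {ι : Type} [Fintype ι] [DecidableEq ι] (H : Matrix ι ι L)
    (hH : H.transpose.map (IsCMField.complexConj L) = H)
    (hanis : ∀ x : ι → L, hermForm (IsCMField.complexConj L : L →+* L) H x x = 0 → x = 0)
    (h3 : 3 ≤ Fintype.card ι) :
    ∃ w : {w : InfinitePlace L // IsComplex w},
      (H.map w.1.embedding).PosDef ∨ (-H.map w.1.embedding).PosDef := by
  obtain ⟨τ, hτ⟩ := hermitianMatrix_exists_posDef_embedding_of_anisotropic L H hH hanis h3
  refine ⟨⟨InfinitePlace.mk τ, IsTotallyComplex.isComplex _⟩, ?_⟩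
  show (H.map (InfinitePlace.mk τ).embedding).PosDef ∨ (-H.map (InfinitePlace.mk τ).embedding).PosDef
  rcases InfinitePlace.embedding_mk_eq τ with h | h
  · rw [h]
    exact hτ
  · rw [h, map_conjugate_eq_transpose_map L H hH τ, ← Matrix.transpose_neg]
    exact hτ.imp Matrix.PosDef.transpose Matrix.PosDef.transpose

end Literature.NumberTheory.QuadraticForms

end
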